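import Literature.AlgebraicGeometry.AbelianSchemes.WeilPairingLevelIsotropyOfIdealTorsionSections
import Literature.AlgebraicGeometry.AbelianSchemes.FibreHomPointsOfFibrePoints
import Literature.AlgebraicGeometry.AbelianSchemes.AbelianSchemeOverRestrictPt
import Literature.AlgebraicGeometry.AbelianSchemes.AbelianSchemeQuotientIsoOfKernelRank
import Literature.AlgebraicGeometry.AbelianSchemes.AbelianSchemeOverFibreDim
import Literature.AlgebraicGeometry.AbelianSchemes.IsLambdaOfAtOntoOfAmpleWitness
import Literature.AlgebraicGeometry.AbelianSchemes.PolarizationLamTranslationInvariance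
import Literature.AlgebraicGeometry.Motives.AbelianVarietyTorsionPointsCountProofs
import HarnessLib

/-!
# The count `#K · #λ_*K₂ = n^{2g}` of the quotient-dual engine read on SECTIONS over an algebraically closed field
# ([MumfordAV1970] §6 App. 3 (p. 64), §7 Thm. 4 (p. 72), §23 p. 233; [MumfordFogartyKirwan1994] Ch. 7 §2 Def. 7.1; [GortzWedhorn2020] (4.7.1))

Layer `Literature/AlgebraicGeometry/AbelianSchemes`, namespace `Literature.AlgebraicGeometry.AbelianSchemes.AbelianSchemeOver`.
THEOREMS ONLY (no definition, no named fact, no instance, no `sorry`).  Cell `hodgecm-mathlib` (D-0151), P6 «MOD» (crux hLiu418 =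
stmt-HodgeConjecture-24832, `--supports`, count-neutral): line L3 ROOF road «DUAL-B̄», RULING #6 (1) «HCARD-SECTIONS» — the COSTUME brick
transporting the points-side count of ★ `AbelianVariety.natCard_mul_natCard_eq_of_idealTorsion` (subgroups of `A_s[n](Ω)` cut out by an
ideal-torsion condition, perfectness of `ē^Θ_n`) to the `hcard` binder of the «DUAL-Q» assembly ★
`nonempty_dualPair_quotient_idealTorsion_geometric`, which is stated on SECTIONS `K, K₂ ≤ A(Spec Ω)` and on the image `λ_*K₂ ≤ Â(Spec Ω)`:
`Nat.card K * Nat.card (K₂.map (σ ↦ σ ≫ λ)) = n ^ (2 * g)`.  HC_CM is proved only modulo the printed citations until rung 0 closes;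
nothing here is about HC.

THE MATHEMATICS (three bookkeeping facts and one count).
(1) SECTIONS = POINTS over a field: for `A → Spec k` and a field-valued point `s : Spec Ω → Spec k`, restriction `σ ↦ σ(s)` is an
injective homomorphism `A(Spec k) → A_s(Ω)` ([MumfordAV1970] §7 Thm. 4 p. 72 uses `X(k) ⊂ X(Ω)`; ★ `restrict_injective_of_field`), and
when `s` is an isomorphism (e.g. `s = 𝟙`, `k = Ω`) it is onto: an `Ω`-point of `A ×_S Spec Ω` is a morphism `Spec Ω → A` over `s`
([GortzWedhorn2020] (4.7.1), ★ `exists_fibrePoints_fibrePointToLeft_eq`), i.e. a section after composing with `s⁻¹`.  Hence an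
`n`-torsion subgroup `K ≤ A(Spec k)` and the subgroup `K₀ ≤ A_s[n](Ω)` of the points `σ(s)`, `σ ∈ K`, have the same cardinality (§2).
(2) `#λ_*K₂ = #K₂` as soon as `λ` is injective on `K₂`; and `σ ≫ λ = 1`, `σ ^ n = 1` force `σ = 1` when `gcd(n, #K(Θ)) = 1` for a witness
`λ̄_s = Λ(𝒪(Θ))` ([MumfordFogartyKirwan1994] Def. 6.3): `σ(s) ∈ ker λ̄_s ⊆ K(Θ)` ([MumfordAV1970] §8 Thm. 1, ★
`IsLambdaOfAt.setOf_map_fibreHom_eq_one_subset_KTheta`), so the order of `σ(s)` divides `n` and `#K(Θ)` (§3).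
(3) `#A_s[n](Ω) = n^{2g}` for `Ω` algebraically closed, `(n : Ω) ≠ 0`, `dim A_s = g` ([MumfordAV1970] §6 App. 3, ★
`natCard_torsionPoints_eq_of_isAlgClosed`, ★ `dim_fibre_of_isOfRelDim`).
(COUNT) Therefore a points-side identity `#K₀ · #K₀′ = #A_s[n](Ω)` for the fibre values of `K` and `K₂` gives
`#K · #λ_*K₂ = n^{2g}` — EXACTLY the `hcard` binder (§2 head `natCard_mul_natCard_map_eq_pow_of_restrictPt`, §3 head
`natCard_mul_natCard_map_eq_pow_of_coprime`).  §4 reads the correspondence clauses «`x ∈ K₀ ↔ ∃ σ ∈ K, σ(s) = x`» off the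
IDEAL-TORSION descriptions on both sides, in the fibre-action currency `φ_s(r) = ι(r)_s` of ★ `WeilPairingLevelIsotropyOfIdealTorsionSections`
(sections killed by `ι(𝔟)` ↔ points killed by `φ_s(𝔟)`, ★ `fibreAction_restrictPt`), so that the consumer's `K₀` IS the subgroup
`A_s[n][𝔟]` of ★ `natCard_mul_natCard_eq_of_idealTorsion`.

* §1 `restrictPt_injective_of_field`, `restrictPt_eq_one_iff_of_field`, `exists_restrictPt_eq_of_isIso`;
* §2 `natCard_eq_natCard_of_restrictPt`, `natCard_map_eq_of_forall_comp_eq_one`, **`natCard_mul_natCard_map_eq_pow_of_restrictPt`**;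
* §3 `eq_one_of_comp_eq_one_of_coprime`, **`natCard_mul_natCard_map_eq_pow_of_coprime`**;
* §4 `forall_fibreAction_restrictPt_eq_one_iff`, `pow_eq_one_of_comp_i_natCast_mem`, `forall_fibreAction_eq_one_iff_exists_restrictPt_eq`,
  `forall_fibreAction_eq_one_iff_exists_restrictPt_eq_of_natCast_mem`, and the ASSEMBLED head **`natCard_mul_natCard_map_eq_pow_of_fibreAction`**.

## References
* [MumfordAV1970] D. Mumford, *Abelian Varieties* (1970), §6 Application 3 (p. 64), §7 Thm. 4 (p. 72), §8 Thm. 1 (p. 77), §23 (p. 233).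
* [MumfordFogartyKirwan1994] D. Mumford, J. Fogarty, F. Kirwan, *Geometric Invariant Theory*, 3rd ed. (1994), Ch. 6 §2 Def. 6.3 (p. 120), Ch. 7 §2 Def. 7.1 (p. 129).
* [GortzWedhorn2020] U. Görtz, T. Wedhorn, *Algebraic Geometry I*, 2nd ed. (2020), Section (4.7), (4.7.1) (p. 108).
-/

set_option autoImplicit false

noncomputable section

universe u

open CategoryTheory CategoryTheory.Limits AlgebraicGeometry MonoidalCategory CartesianMonoidalCategory
open scoped MonObj

namespace Literature.AlgebraicGeometry.AbelianSchemes.AbelianSchemeOver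

open Literature.AlgebraicGeometry.Motives

/-! ### §1 Sections versus `Ω`-points of a fibre over a field -/

section Field

variable {k : Type u} [Field k] (A : AbelianSchemeOver (Spec (.of k))) {Ω : Type u} [Field Ω] (s : Spec (.of Ω) ⟶ Spec (.of k))

/-- **Over a field, `σ ↦ σ(s)` is injective** on sections, in the `Ω`-points-of-the-fibre currency `restrictPt` (★ `restrict_injective_of_field`
read through ★ `restrictPt_eq_restrictPt_iff`). [cite: MumfordAV1970, §7 Thm. 4 (p. 72)] [cite: MumfordFogartyKirwan1994, Ch. 7 §2 Definition 7.1 (p. 129)] -/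
theorem restrictPt_injective_of_field : Function.Injective (A.restrictPt s) := fun σ τ h =>
  A.restrict_injective_of_field s ((A.restrictPt_eq_restrictPt_iff s σ τ).1 h)

/-- `σ(s) = 1 ↔ σ = 1` over a field, the left-hand equation read in the `Points` currency of the fibre abelian variety `A_s` (where Weil
pairings, the fibre action `φ_s` and ideal torsion live). [cite: MumfordAV1970, §7 Thm. 4 (p. 72)] -/
theorem restrictPt_eq_one_iff_of_field (σ : A.Sections) :
    @Eq ((A.fibre s).toAbelianVariety.Points Ω) (A.restrictPt s σ) 1 ↔ σ = 1 :=
  ⟨fun h => A.restrictPt_injective_of_field s (h.trans (A.restrictPt_one s).symm), fun h => by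
    rw [h]
    exact A.restrictPt_one s⟩

end Field

section IsoPoint

variable {S : Scheme.{u}} (A : AbelianSchemeOver S) {Ω : Type u} [Field Ω] (s : Spec (.of Ω) ⟶ S)

/-- **Over an ISOMORPHISM point every `Ω`-point of the fibre is the value of a section**: for `s : Spec Ω ⥲ S` (e.g. `s = 𝟙_{Spec Ω}`) and
`P ∈ A_s(Ω)`, `P = σ(s)` with `σ := s⁻¹ ≫ x` for the `S`-morphism `x : Spec Ω → A` over `s` underlying `P` ([GortzWedhorn2020] (4.7.1), ★
`exists_fibrePoints_fibrePointToLeft_eq`, ★ `eq_restrictPt_iff_eq_restrict`). [cite: GortzWedhorn2020, Section (4.7), (4.7.1) (p. 108)]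
[cite: MumfordFogartyKirwan1994, Ch. 7 §2 Definition 7.1 (p. 129)] -/
theorem exists_restrictPt_eq_of_isIso [IsIso s] (P : (A.fibre s).toAbelianVariety.Points Ω) :
    ∃ σ : A.Sections, A.restrictPt s σ = P := by
  obtain ⟨x, hx⟩ := A.exists_fibrePoints_fibrePointToLeft_eq s P
  have hw : (inv s ≫ (x.left : Spec (.of Ω) ⟶ A.X.left) : S ⟶ A.X.left) ≫ A.X.hom = 𝟙 S := by
    rw [Category.assoc]
    erw [Over.w x]
    exact IsIso.inv_hom_id s
  refine ⟨Over.homMk (inv s ≫ (x.left : Spec (.of Ω) ⟶ A.X.left) : S ⟶ A.X.left) (by rw [Over.tensorUnit_hom]; exact hw),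
    ((eq_restrictPt_iff_eq_restrict s hx _).2 ?_).symm⟩
  ext
  exact (IsIso.hom_inv_id_assoc s (x.left : Spec (.of Ω) ⟶ A.X.left)).symm

end IsoPoint

/-! ### §2 The count on sections from a count on fibre points -/

section Count

variable {k : Type u} [Field k] (A : AbelianSchemeOver (Spec (.of k))) {Ω : Type u} [Field Ω] (s : Spec (.of Ω) ⟶ Spec (.of k))

/-- **`#K = #K₀`** for an `n`-torsion subgroup `K ≤ A(Spec k)` of sections and the subgroup `K₀ ≤ A_s[n](Ω)` of its fibre values
(`x ∈ K₀ ↔ ∃ σ ∈ K, σ(s) = x`): `σ ↦ σ(s)` is a bijection `K → K₀` (injective over a field, §1). [cite: MumfordAV1970, §7 Thm. 4 (p. 72)]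
[cite: MumfordFogartyKirwan1994, Ch. 7 §2 Definition 7.1 (p. 129)] -/
theorem natCard_eq_natCard_of_restrictPt {n : ℕ} (K : Subgroup A.Sections) (hKn : ∀ σ : K, (σ : A.Sections) ^ n = 1)
    (K₀ : Subgroup ((A.fibre s).toAbelianVariety.torsionPoints Ω n))
    (hK : ∀ x : (A.fibre s).toAbelianVariety.torsionPoints Ω n,
      x ∈ K₀ ↔ ∃ σ ∈ K, (x : (A.fibre s).toAbelianVariety.Points Ω) = A.restrictPt s σ) :
    Nat.card K = Nat.card K₀ := by
  have hmem : ∀ σ : K, (A.restrictPt s (σ : A.Sections) : (A.fibre s).toAbelianVariety.Points Ω) ∈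
      (A.fibre s).toAbelianVariety.torsionPoints Ω n := fun σ =>
    (AbelianVariety.mem_torsionPoints_iff _ _).2 (by
      rw [zpow_natCast]
      exact A.restrictPt_pow_eq_one s (hKn σ))
  refine Nat.card_congr (Equiv.ofBijective
    (fun σ : K => (⟨⟨A.restrictPt s (σ : A.Sections), hmem σ⟩, (hK _).2 ⟨σ, σ.2, rfl⟩⟩ : K₀)) ⟨?_, ?_⟩)
  · intro σ τ h
    have h' := congrArg (fun z : K₀ => ((z : (A.fibre s).toAbelianVariety.torsionPoints Ω n) : (A.fibre s).toAbelianVariety.Points Ω)) h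
    exact Subtype.ext (A.restrictPt_injective_of_field s h')
  · intro x
    obtain ⟨σ, hσ, h⟩ := (hK x).1 x.2
    exact ⟨⟨σ, hσ⟩, Subtype.ext (Subtype.ext h.symm)⟩

end Count

section Image

variable {S : Scheme.{u}} (A : AbelianSchemeOver S) {B : AbelianSchemeOver S} (f : A.X ⟶ B.X) [IsMonHom f]

/-- **`#f_*K = #K` when `f` kills no non-trivial element of `K`** (`f_*K = K.map (σ ↦ σ ≫ f)`, ★ `isMonHom_monoidHom_apply`): a
homomorphism with trivial kernel on the subgroup `K` is injective on `K`. [cite: MumfordAV1970, §7 Thm. 4 (p. 72)] -/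
theorem natCard_map_eq_of_forall_comp_eq_one (K : Subgroup A.Sections) (hinj : ∀ σ ∈ K, σ ≫ f = 1 → σ = 1) :
    Nat.card (K.map (IsMonHom.monoidHom f (𝟙_ (Over S)))) = Nat.card K := by
  have hinjOn : Set.InjOn (IsMonHom.monoidHom f (𝟙_ (Over S))) (K : Set A.Sections) := by
    intro σ hσ τ hτ h
    have h1 : (σ * τ⁻¹) ≫ f = 1 := by
      rw [← isMonHom_monoidHom_apply, map_mul, map_inv, h, mul_inv_cancel]
    exact mul_inv_eq_one.1 (hinj _ (K.mul_mem hσ (K.inv_mem hτ)) h1)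
  calc Nat.card (K.map (IsMonHom.monoidHom f (𝟙_ (Over S))))
        = Nat.card ((IsMonHom.monoidHom f (𝟙_ (Over S))) '' (K : Set A.Sections)) := rfl
    _ = Nat.card K := Nat.card_image_of_injOn hinjOn

end Image

section Head

variable {Ω : Type u} [Field Ω] [IsAlgClosed Ω] (A : AbelianSchemeOver (Spec (.of Ω))) {B : AbelianSchemeOver (Spec (.of Ω))}
  (lam : A.X ⟶ B.X) [IsMonHom lam]

/-- **«HCARD-SECTIONS» — `#K · #λ_*K₂ = n^{2g}` FROM A COUNT ON FIBRE POINTS.**  `A → Spec Ω` (`Ω` algebraically closed) of relative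
dimension `g`, `λ : A → B` a homomorphism, `(n : Ω) ≠ 0`, `s : Spec Ω → Spec Ω` a point; `K, K₂ ≤ A(Spec Ω)` `n`-torsion subgroups of
sections with `λ` injective on `K₂`; `K₀, K₀′ ≤ A_s[n](Ω)` the subgroups of their fibre values (`x ∈ K₀ ↔ ∃ σ ∈ K, σ(s) = x`, same for
`K₂, K₀′`).  If `#K₀ · #K₀′ = #A_s[n](Ω)` then `Nat.card K * Nat.card (K₂.map (σ ↦ σ ≫ λ)) = n ^ (2 * g)` — the `hcard` binder of ★
`nonempty_dualPair_quotient_idealTorsion_geometric`, token for token (`B := Â`).  (§2: `#K = #K₀`, `#K₂ = #K₀′`, `#λ_*K₂ = #K₂`;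
`#A_s[n](Ω) = n^{2 dim A_s}` ★ `natCard_torsionPoints_eq_of_isAlgClosed`; `dim A_s = g` ★ `dim_fibre_of_isOfRelDim`.)
[cite: MumfordAV1970, §6 Application 3 (p. 64) and §23 (p. 233)] [cite: MumfordFogartyKirwan1994, Ch. 7 §2 Definition 7.1 (p. 129)] -/
theorem natCard_mul_natCard_map_eq_pow_of_restrictPt {g : ℕ} (hA : A.IsOfRelDim g) {n : ℕ} (hn0 : (n : Ω) ≠ 0)
    (s : Spec (.of Ω) ⟶ Spec (.of Ω))
    (K : Subgroup A.Sections) (hK : ∀ σ : K, (σ : A.Sections) ^ n = 1)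
    (K₂ : Subgroup A.Sections) (hK₂ : ∀ σ : K₂, (σ : A.Sections) ^ n = 1) (hinj : ∀ σ ∈ K₂, σ ≫ lam = 1 → σ = 1)
    (K₀ K₀' : Subgroup ((A.fibre s).toAbelianVariety.torsionPoints Ω n))
    (hK₀ : ∀ x : (A.fibre s).toAbelianVariety.torsionPoints Ω n,
      x ∈ K₀ ↔ ∃ σ ∈ K, (x : (A.fibre s).toAbelianVariety.Points Ω) = A.restrictPt s σ)
    (hK₀' : ∀ y : (A.fibre s).toAbelianVariety.torsionPoints Ω n,
      y ∈ K₀' ↔ ∃ σ ∈ K₂, (y : (A.fibre s).toAbelianVariety.Points Ω) = A.restrictPt s σ)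
    (hcount : Nat.card K₀ * Nat.card K₀' = Nat.card ((A.fibre s).toAbelianVariety.torsionPoints Ω n)) :
    Nat.card K * Nat.card (K₂.map (IsMonHom.monoidHom lam (𝟙_ (Over (Spec (.of Ω)))))) = n ^ (2 * g) := by
  rw [A.natCard_map_eq_of_forall_comp_eq_one lam K₂ hinj, A.natCard_eq_natCard_of_restrictPt s K hK K₀ hK₀,
    A.natCard_eq_natCard_of_restrictPt s K₂ hK₂ K₀' hK₀', hcount,
    AbelianVariety.natCard_torsionPoints_eq_of_isAlgClosed (A.fibre s).toAbelianVariety Ω (n : ℤ) (by exact_mod_cast hn0),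
    Int.natAbs_natCast, dim_fibre_of_isOfRelDim hA s]

end Head

/-! ### §3 Injectivity of `λ` on `n`-torsion sections from `gcd(n, #K(Θ)) = 1` -/

section Coprime

variable {Ω : Type u} [Field Ω] (A : AbelianSchemeOver (Spec (.of Ω))) (D : A.DualPair) (lam : A.X ⟶ D.hat.X) [IsMonHom lam]
  (s : Spec (.of Ω) ⟶ Spec (.of Ω)) {Θ : CartierDivisor (A.fibre s).toAbelianVariety.X.left}

/-- **An `n`-torsion section killed by `λ` is trivial when `gcd(n, #K(Θ)) = 1`**, for a witness `λ̄_s = Λ(𝒪(Θ))` at a field point `s` of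
`Spec Ω`: `σ(s) ∈ ker λ̄_s ⊆ K(Θ)` ([MumfordAV1970] §8 Thm. 1; ★ `IsLambdaOfAt.setOf_map_fibreHom_eq_one_subset_KTheta`, ★
`map_fibreHom_restrictPt`), so the order of `σ(s)` divides both `n` and `#K(Θ)` (Mathlib `orderOf_dvd_natCard`, no finiteness needed), hence
`σ(s) = 1` and `σ = 1` (§1).  With ★ `exists_coprime_representative_coprime_level` (`gcd(n, #K(Θ_s)) = 1`) this discharges the injectivity
input of §2. [cite: MumfordAV1970, §8 Thm. 1 (p. 77)] [cite: MumfordFogartyKirwan1994, Ch. 6 §2 Definition 6.3 (p. 120)] -/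
theorem eq_one_of_comp_eq_one_of_coprime (hΘ : A.IsLambdaOfAt s D lam Θ) {n : ℕ}
    (hcop : Nat.Coprime n (Nat.card ((A.fibre s).toAbelianVariety.KTheta Θ)))
    (σ : A.Sections) (hσn : σ ^ n = 1) (hσ : σ ≫ lam = 1) : σ = 1 := by
  have hker : AlgPoints.map (fibreHom lam s).hom.hom.hom (A.restrictPt s σ) = 1 := by
    rw [map_fibreHom_restrictPt s lam σ, hσ]
    exact D.hat.restrictPt_one s
  have hmem : A.restrictPt s σ ∈ (A.fibre s).toAbelianVariety.KTheta Θ :=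
    hΘ.setOf_map_fibreHom_eq_one_subset_KTheta A D s hker
  have h1 : orderOf (⟨A.restrictPt s σ, hmem⟩ : (A.fibre s).toAbelianVariety.KTheta Θ) = 1 := by
    refine Nat.eq_one_of_dvd_coprimes hcop ?_ (orderOf_dvd_natCard _)
    refine orderOf_dvd_of_pow_eq_one (Subtype.ext ?_)
    rw [Subgroup.coe_pow, Subgroup.coe_one]
    exact A.restrictPt_pow_eq_one s hσn
  have h2 := congrArg Subtype.val (orderOf_eq_one_iff.1 h1)
  exact A.restrictPt_injective_of_field s (h2.trans (A.restrictPt_one s).symm)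

/-- **«HCARD-SECTIONS» WITH THE INJECTIVITY DISCHARGED BY `gcd(n, #K(Θ)) = 1`**: §2 head with `hinj` replaced by a witness
`λ̄_s = Λ(𝒪(Θ))` and `Nat.Coprime n (Nat.card K(Θ))`; conclusion = the `hcard` binder of ★ `nonempty_dualPair_quotient_idealTorsion_geometric`
token for token. [cite: MumfordAV1970, §6 Application 3 (p. 64), §8 Thm. 1 (p. 77) and §23 (p. 233)] [cite: MumfordFogartyKirwan1994, Ch. 7 §2 Definition 7.1 (p. 129)] -/
theorem natCard_mul_natCard_map_eq_pow_of_coprime [IsAlgClosed Ω] {g : ℕ} (hA : A.IsOfRelDim g) {n : ℕ} (hn0 : (n : Ω) ≠ 0)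
    (hΘ : A.IsLambdaOfAt s D lam Θ) (hcop : Nat.Coprime n (Nat.card ((A.fibre s).toAbelianVariety.KTheta Θ)))
    (K : Subgroup A.Sections) (hK : ∀ σ : K, (σ : A.Sections) ^ n = 1)
    (K₂ : Subgroup A.Sections) (hK₂ : ∀ σ : K₂, (σ : A.Sections) ^ n = 1)
    (K₀ K₀' : Subgroup ((A.fibre s).toAbelianVariety.torsionPoints Ω n))
    (hK₀ : ∀ x : (A.fibre s).toAbelianVariety.torsionPoints Ω n,
      x ∈ K₀ ↔ ∃ σ ∈ K, (x : (A.fibre s).toAbelianVariety.Points Ω) = A.restrictPt s σ)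
    (hK₀' : ∀ y : (A.fibre s).toAbelianVariety.torsionPoints Ω n,
      y ∈ K₀' ↔ ∃ σ ∈ K₂, (y : (A.fibre s).toAbelianVariety.Points Ω) = A.restrictPt s σ)
    (hcount : Nat.card K₀ * Nat.card K₀' = Nat.card ((A.fibre s).toAbelianVariety.torsionPoints Ω n)) :
    Nat.card K * Nat.card (K₂.map (IsMonHom.monoidHom lam (𝟙_ (Over (Spec (.of Ω)))))) = n ^ (2 * g) :=
  A.natCard_mul_natCard_map_eq_pow_of_restrictPt lam hA hn0 s K hK K₂ hK₂
    (fun σ hσ h => A.eq_one_of_comp_eq_one_of_coprime D lam s hΘ hcop σ (hK₂ ⟨σ, hσ⟩) h) K₀ K₀' hK₀ hK₀' hcount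

end Coprime

/-! ### §4 The correspondence clauses from ideal-torsion descriptions (fibre-action currency `φ_s(r) = ι(r)_s`) -/

section FibreAction

variable {k : Type u} [Field k] (A : AbelianSchemeOver (Spec (.of k))) {O : Type*} [CommRing O] (act : A.RingAction O)
  {Ω : Type u} [Field Ω] (s : Spec (.of Ω) ⟶ Spec (.of k))
  (φ : O → (A.fibre s).toAbelianVariety.Points Ω → (A.fibre s).toAbelianVariety.Points Ω)
  (hφ : ∀ r x, φ r x = haveI := act.isMonHom r; AlgPoints.map (fibreHom (act.i r) s).hom.hom.hom x)

include hφ in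
/-- **`φ_s(T)` kills `σ(s)` iff `ι(T)` kills `σ`** for a section `σ ∈ A(Spec k)` and any set `T ⊆ 𝒪` (★ `fibreAction_restrictPt`: `φ_s(r)(σ(s)) =
(σ ≫ ι(r))(s)`, and §1 injectivity). [cite: MumfordFogartyKirwan1994, Ch. 7 §2 Definition 7.1 (p. 129)] [cite: MumfordAV1970, §7 Thm. 4 (p. 72)] -/
theorem forall_fibreAction_restrictPt_eq_one_iff (T : Set O) (σ : A.Sections) :
    (∀ b ∈ T, φ b (A.restrictPt s σ) = 1) ↔ ∀ b ∈ T, σ ≫ act.i b = 1 := by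
  refine forall₂_congr fun b _ => ?_
  rw [fibreAction_restrictPt act s φ hφ]
  exact A.restrictPt_eq_one_iff_of_field s (σ ≫ act.i b)

/-- **A section killed by `ι(𝔟)` with `n ∈ 𝔟` is `n`-torsion**: `σ ≫ ι(n) = σ ^ n` (★ `RingAction.i_nsmul`, `i_one`, Mathlib `MonObj.comp_pow`).
[cite: MumfordAV1970, §7 Thm. 4 (p. 72)] -/
theorem pow_eq_one_of_comp_i_natCast_mem {S : Scheme.{u}} {A : AbelianSchemeOver S} (act : A.RingAction O) {𝔟 : Ideal O} {n : ℕ}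
    (hn : (n : O) ∈ 𝔟) (σ : A.Sections) (hσ : ∀ b ∈ 𝔟, σ ≫ act.i b = 1) : σ ^ n = 1 := by
  have h := hσ (n : O) hn
  rwa [← Nat.smul_one_eq_cast, act.i_nsmul, act.i_one, MonObj.comp_pow, Category.comp_id] at h

include hφ in
/-- **THE CORRESPONDENCE CLAUSE over an isomorphism point**: if `K ≤ A(Spec k)` is the subgroup of `n`-torsion sections killed by `ι(T)`, then
an `n`-torsion point `x ∈ A_s[n](Ω)` is killed by `φ_s(T)` iff `x = σ(s)` for some `σ ∈ K` (`s : Spec Ω ⥲ Spec k`; §1 `exists_restrictPt_eq_of_isIso`,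
`restrictPt_injective_of_field`, `forall_fibreAction_restrictPt_eq_one_iff`) — so the points-side subgroup «`A_s[n][𝔟]`» of ★
`natCard_mul_natCard_eq_of_idealTorsion` satisfies the `hK₀` clause of the §2∕§3 heads. [cite: MumfordAV1970, §7 Thm. 4 (p. 72)]
[cite: GortzWedhorn2020, Section (4.7), (4.7.1) (p. 108)] -/
theorem forall_fibreAction_eq_one_iff_exists_restrictPt_eq [IsIso s] (K : Subgroup A.Sections) {n : ℕ} (T : Set O)
    (hKiff : ∀ σ : A.Sections, σ ∈ K ↔ σ ^ n = 1 ∧ ∀ b ∈ T, σ ≫ act.i b = 1)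
    (x : (A.fibre s).toAbelianVariety.torsionPoints Ω n) :
    (∀ b ∈ T, φ b (x : (A.fibre s).toAbelianVariety.Points Ω) = 1) ↔
      ∃ σ ∈ K, (x : (A.fibre s).toAbelianVariety.Points Ω) = A.restrictPt s σ := by
  constructor
  · intro hx
    obtain ⟨σ, hσ⟩ := A.exists_restrictPt_eq_of_isIso s (x : (A.fibre s).toAbelianVariety.Points Ω)
    refine ⟨σ, (hKiff σ).2 ⟨?_, fun b hb => ?_⟩, hσ.symm⟩
    · apply A.restrictPt_injective_of_field s
      rw [restrictPt_pow, restrictPt_one, hσ]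
      exact AbelianVariety.coe_torsionPoints_pow_eq_one x
    · apply A.restrictPt_injective_of_field s
      rw [← fibreAction_restrictPt act s φ hφ, restrictPt_one, hσ]
      exact hx b hb
  · rintro ⟨σ, hσK, hσ⟩ b hb
    rw [hσ, fibreAction_restrictPt act s φ hφ, ((hKiff σ).1 hσK).2 b hb]
    exact A.restrictPt_one s

include hφ in
/-- The same with `K := ` ALL sections killed by an ideal `𝔟 ∋ n` (then `K` is `n`-torsion automatically, `pow_eq_one_of_comp_i_natCast_mem`) —
the shape in which ★ `DivisibleTorsionPointCount.exists_subgroup_coe_eq` produces `K = A(Spec k)[𝔟]`. [cite: MumfordAV1970, §7 Thm. 4 (p. 72)]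
[cite: GortzWedhorn2020, Section (4.7), (4.7.1) (p. 108)] -/
theorem forall_fibreAction_eq_one_iff_exists_restrictPt_eq_of_natCast_mem [IsIso s] (K : Subgroup A.Sections) {𝔟 : Ideal O} {n : ℕ}
    (hn : (n : O) ∈ 𝔟) (hKiff : ∀ σ : A.Sections, σ ∈ K ↔ ∀ b ∈ 𝔟, σ ≫ act.i b = 1)
    (x : (A.fibre s).toAbelianVariety.torsionPoints Ω n) :
    (∀ b ∈ 𝔟, φ b (x : (A.fibre s).toAbelianVariety.Points Ω) = 1) ↔
      ∃ σ ∈ K, (x : (A.fibre s).toAbelianVariety.Points Ω) = A.restrictPt s σ :=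
  A.forall_fibreAction_eq_one_iff_exists_restrictPt_eq act s φ hφ K (𝔟 : Set O)
    (fun σ => (hKiff σ).trans ⟨fun h => ⟨pow_eq_one_of_comp_i_natCast_mem act hn σ h, h⟩, fun h => h.2⟩) x

end FibreAction

/-! ### §5 The assembled head in the fibre-action currency -/

section Assembled

variable {Ω : Type u} [Field Ω] [IsAlgClosed Ω] (A : AbelianSchemeOver (Spec (.of Ω))) (D : A.DualPair) (lam : A.X ⟶ D.hat.X)
  [IsMonHom lam] {O : Type*} [CommRing O] (act : A.RingAction O) (s : Spec (.of Ω) ⟶ Spec (.of Ω))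
  (φ : O → (A.fibre s).toAbelianVariety.Points Ω → (A.fibre s).toAbelianVariety.Points Ω)
  (hφ : ∀ r x, φ r x = haveI := act.isMonHom r; AlgPoints.map (fibreHom (act.i r) s).hom.hom.hom x)

include hφ in
/-- **«HCARD-SECTIONS», ASSEMBLED: the `hcard` binder of ★ `nonempty_dualPair_quotient_idealTorsion_geometric` from the points-side count of ★
`natCard_mul_natCard_eq_of_idealTorsion`.**  Over `Spec Ω` (`Ω` algebraically closed), at an isomorphism point `s` (e.g. `𝟙`): `A` of relative
dimension `g` with `ι : 𝒪 → End(A)`, `λ : A → Â` with a witness `λ̄_s = Λ(𝒪(Θ))` and `gcd(n, #K(Θ)) = 1`, `(n : Ω) ≠ 0`; `K = ` the `n`-torsion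
sections killed by `ι(T)`, `K₂ = ` those killed by `ι(T₂)` (membership clauses); `K₀, K₀′ ≤ A_s[n](Ω)` the points killed by `φ_s(T)`, `φ_s(T₂)`
(membership clauses, `φ_s` the fibre action); if `#K₀ · #K₀′ = #A_s[n](Ω)` then `Nat.card K * Nat.card (K₂.map (σ ↦ σ ≫ λ)) = n ^ (2 * g)`.
[cite: MumfordAV1970, §6 Application 3 (p. 64), §7 Thm. 4 (p. 72), §8 Thm. 1 (p. 77) and §23 (p. 233)] [cite: MumfordFogartyKirwan1994, Ch. 7 §2 Definition 7.1 (p. 129)] -/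
theorem natCard_mul_natCard_map_eq_pow_of_fibreAction [IsIso s] {g : ℕ} (hA : A.IsOfRelDim g) {n : ℕ} (hn0 : (n : Ω) ≠ 0)
    {Θ : CartierDivisor (A.fibre s).toAbelianVariety.X.left} (hΘ : A.IsLambdaOfAt s D lam Θ)
    (hcop : Nat.Coprime n (Nat.card ((A.fibre s).toAbelianVariety.KTheta Θ)))
    (T T₂ : Set O) (K K₂ : Subgroup A.Sections)
    (hKiff : ∀ σ : A.Sections, σ ∈ K ↔ σ ^ n = 1 ∧ ∀ b ∈ T, σ ≫ act.i b = 1)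
    (hK₂iff : ∀ σ : A.Sections, σ ∈ K₂ ↔ σ ^ n = 1 ∧ ∀ r ∈ T₂, σ ≫ act.i r = 1)
    (K₀ K₀' : Subgroup ((A.fibre s).toAbelianVariety.torsionPoints Ω n))
    (hK₀ : ∀ x : (A.fibre s).toAbelianVariety.torsionPoints Ω n,
      x ∈ K₀ ↔ ∀ b ∈ T, φ b (x : (A.fibre s).toAbelianVariety.Points Ω) = 1)
    (hK₀' : ∀ y : (A.fibre s).toAbelianVariety.torsionPoints Ω n,
      y ∈ K₀' ↔ ∀ r ∈ T₂, φ r (y : (A.fibre s).toAbelianVariety.Points Ω) = 1)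
    (hcount : Nat.card K₀ * Nat.card K₀' = Nat.card ((A.fibre s).toAbelianVariety.torsionPoints Ω n)) :
    Nat.card K * Nat.card (K₂.map (IsMonHom.monoidHom lam (𝟙_ (Over (Spec (.of Ω)))))) = n ^ (2 * g) :=
  A.natCard_mul_natCard_map_eq_pow_of_coprime D lam s hA hn0 hΘ hcop K (fun σ => ((hKiff σ).1 σ.2).1) K₂
    (fun σ => ((hK₂iff σ).1 σ.2).1) K₀ K₀'
    (fun x => (hK₀ x).trans (A.forall_fibreAction_eq_one_iff_exists_restrictPt_eq act s φ hφ K T hKiff x))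
    (fun y => (hK₀' y).trans (A.forall_fibreAction_eq_one_iff_exists_restrictPt_eq act s φ hφ K₂ T₂ hK₂iff y)) hcount

end Assembled

end Literature.AlgebraicGeometry.AbelianSchemes.AbelianSchemeOver

end
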